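import Summits.CriticalPhenomena.PercolationContinuityZ3.Theorems.PercNearOneGluingNoHeavyLowerTailSahiHittingWidthFour
import Summits.CriticalPhenomena.PercolationContinuityZ3.Theorems.PercNearOneGluingNoHeavyLowerTailSahiHittingFive
import HarnessLib

/-!
# `NoHeavyLowerTail` (stmt-CriticalPhenomena-4575) — SAHI POSITIVITY AT EVERY ORDER for hitting families of WIDTH ≤ 5

Support file, seat `prim-l12-p5` (gen 12), `--supports stmt-CriticalPhenomena-4575`, COMPUTATIONAL (it inherits the kernel
certificates of the hitting `C₄` (`…SahiE4HittingEvents`) and of the hitting `C₅` for every product measure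
(`…SahiHittingFive`, `SahiHitting.bernoulliWeight_sahiE5_hit_nonneg`, gen 10, p247610)).  No definitions, no named facts, no sorries.

Companion of `…SahiHittingWidthThree` (standard axioms) and `…SahiHittingWidthFour`: with the hitting `C₅` available for
quintuples, the locality-in-width reduction (`SahiHitting.prodBernoulli_sahiE_hit_nonneg_of_nested`, Theorem G′ of
`…SahiHereditaryMeetAbsorption`) runs with `k = 5`, so SIX-wise absorption suffices — among any six indices two must carry
nested sets.

* `sahiE_hit_subfamily_nonneg_of_card_le_five`: sub-families of size ≤ 5 of a hitting family are nonnegative.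
* **`prodBernoulli_sahiE_hit_nonneg_of_width_le_five`** (main): hitting families `A : Fin m → Finset ι` in which any six
  indices contain a nested pair (`A i ⊆ A j`; equal sets count) have `0 ≤ E_m(1_{H_{A_0}}, …, 1_{H_{A_{m−1}}})` for every `m`
  and every product weight `bernoulliWeight p`.
* `prodBernoulli_sahiE_hit_nonneg_of_card_le_five`: any `m ≤ 5` finite sets (Sahi's `C_1,…,C_5` for hitting events in one statement).
* `prodBernoulli_sahiE_hit_nonneg_of_five_sets`: at most five distinct sets with arbitrary multiplicities — every coefficient
  of Sahi's generating function [Sahi2008, Conj. 4] of five hitting events `H_{A_0},…,H_{A_4}` is nonnegative.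
* `prodBernoulli_sahiE_someClosed_nonneg_of_width_le_five`: the decreasing form ("some coordinate of `A_k` closed") by reflection.

What remains open for hitting events: `C_m`, `m ≥ 6`, on families containing six pairwise `⊆`-incomparable sets
(order 6 itself is known for depth ≤ 2, `…SahiHittingDepthTwoSixModel`, and on the exchangeable slice, `…ExchangeableSixModel`).
-/

namespace Summit.CriticalPhenomena.PercolationContinuityZ3.Theorems

namespace SahiHitting

open Finset Function Literature.Combinatorics.Sahi2008 SahiMomentExpansion
open Literature.Probability.Percolation.DecisionTree (ind ind_nonneg)

variable {ι : Type*} [Fintype ι] [DecidableEq ι]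

/-- Sub-families of size `≤ 5` of a hitting family are nonnegative: sizes ≤ 4 by `…WidthFour`, size 5 by the hitting `C₅`
for every product measure (`bernoulliWeight_sahiE5_hit_nonneg`, kernel certificate). [this work] -/
theorem sahiE_hit_subfamily_nonneg_of_card_le_five (p : ι → unitInterval) {m : ℕ} (A : Fin m → Finset ι)
    (S : Finset (Fin m)) (hSne : S.Nonempty) (hS5 : S.card ≤ 5) :
    0 ≤ sahiE (bernoulliWeight p) S.card (fun j => ind {ω : Set ι | ∃ a ∈ A (S.orderEmbOfFin rfl j), a ∈ ω}) := by
  classical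
  rcases Nat.lt_or_ge S.card 5 with h | h
  · exact sahiE_hit_subfamily_nonneg_of_card_le_four p A S hSne (by omega)
  · have h5 : S.card = 5 := le_antisymm hS5 h
    rw [← sahiE_cast (bernoulliWeight p) h5.symm]
    have e1 : ∀ j : Fin 5, S.orderEmbOfFin rfl (Fin.cast h5.symm j) = S.orderEmbOfFin h5 j := fun j =>
      Finset.orderEmbOfFin_eq_orderEmbOfFin_iff.mpr rfl
    simp only [e1]
    exact bernoulliWeight_sahiE5_hit_nonneg p (fun j => A (S.orderEmbOfFin h5 j))

/-- **Sahi positivity at every order for hitting families of width ≤ 5.**  Product Bernoulli weight on `2^ι` (`ι` finite);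
if among any six indices two carry nested sets (`A i ⊆ A j`; equal sets count), then
`0 ≤ E_m(1_{H_{A_0}}, …, 1_{H_{A_{m−1}}})` for every `m`.  Inputs: FKG, hitting `C₃`, `C₄`, `C₅` (the last two computational),
Theorem G′. [this work] -/
theorem prodBernoulli_sahiE_hit_nonneg_of_width_le_five (p : ι → unitInterval) (m : ℕ) (A : Fin m → Finset ι)
    (hw : ∀ S : Finset (Fin m), S.card = 6 → ∃ i ∈ S, ∃ j ∈ S, i ≠ j ∧ A i ⊆ A j) :
    0 ≤ sahiE (bernoulliWeight p) m (fun l => ind {ω : Set ι | ∃ a ∈ A l, a ∈ ω}) :=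
  prodBernoulli_sahiE_hit_nonneg_of_nested p (by norm_num : 1 ≤ 5) m A
    (fun S hSne hS5 => sahiE_hit_subfamily_nonneg_of_card_le_five p A S hSne hS5) hw

/-- **Sahi's `C_1,…,C_5` for hitting events of every product measure, in one statement**: for any `m ≤ 5` finite sets,
`0 ≤ E_m(1_{H_{A_0}}, …, 1_{H_{A_{m−1}}})`. [this work] -/
theorem prodBernoulli_sahiE_hit_nonneg_of_card_le_five (p : ι → unitInterval) {m : ℕ} (hm : m ≤ 5) (A : Fin m → Finset ι) :
    0 ≤ sahiE (bernoulliWeight p) m (fun l => ind {ω : Set ι | ∃ a ∈ A l, a ∈ ω}) := by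
  refine prodBernoulli_sahiE_hit_nonneg_of_width_le_five p m A fun S hS => ?_
  have : S.card ≤ m := by simpa using S.card_le_univ
  omega

/-- **At most five distinct sets, arbitrary multiplicities.**  For finite `B_0, …, B_4 ⊆ ι` and any assignment
`c : Fin m → Fin 5` of slots to sets, `0 ≤ E_m(1_{H_{B_{c 0}}}, …, 1_{H_{B_{c (m−1)}}})` (pigeonhole).  Equivalently: every
coefficient of Sahi's generating function of five hitting events is nonnegative. [this work; cite: Sahi2008, Conj. 4] -/
theorem prodBernoulli_sahiE_hit_nonneg_of_five_sets (p : ι → unitInterval) (B : Fin 5 → Finset ι) (m : ℕ)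
    (c : Fin m → Fin 5) :
    0 ≤ sahiE (bernoulliWeight p) m (fun l => ind {ω : Set ι | ∃ a ∈ B (c l), a ∈ ω}) := by
  refine prodBernoulli_sahiE_hit_nonneg_of_width_le_five p m (fun l => B (c l)) fun S hS => ?_
  have hlt : (Finset.univ : Finset (Fin 5)).card < S.card := by simp [hS]
  obtain ⟨i, hi, j, hj, hij, hc⟩ := Finset.exists_ne_map_eq_of_card_lt_of_maps_to hlt (f := c) fun _ _ => Finset.mem_univ _
  exact ⟨i, hi, j, hj, hij, by simp [hc]⟩

/-- **Decreasing form, width ≤ 5, every order** (computational): for the events `D_{A_k} = {ω | ∃ a ∈ A_k, a ∉ ω}` ("some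
coordinate of `A_k` is closed"), if among any six indices two carry nested sets then `0 ≤ E_m(1_{D_{A_0}}, …, 1_{D_{A_{m−1}}})`
for every product weight and every `m` — reflection onto the hitting form (`sahiE_someClosed_eq_sahiE_hit`). [this work] -/
theorem prodBernoulli_sahiE_someClosed_nonneg_of_width_le_five (q : ι → unitInterval) (m : ℕ) (A : Fin m → Finset ι)
    (hw : ∀ S : Finset (Fin m), S.card = 6 → ∃ i ∈ S, ∃ j ∈ S, i ≠ j ∧ A i ⊆ A j) :
    0 ≤ sahiE (bernoulliWeight q) m (fun l => ind {ω : Set ι | ∃ a ∈ A l, a ∉ ω}) := by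
  rw [sahiE_someClosed_eq_sahiE_hit]
  exact prodBernoulli_sahiE_hit_nonneg_of_width_le_five _ m A hw

end SahiHitting

end Summit.CriticalPhenomena.PercolationContinuityZ3.Theorems
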